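import Summits.BirchSwinnertonDyer.BirchSwinnertonDyer.Theorems.ErratumRoadFiveTransvectionIrreducibility
import Summits.BirchSwinnertonDyer.BirchSwinnertonDyer.Theorems.ErratumRoadFiveResidualRepOfMemberTorsion
import Summits.BirchSwinnertonDyer.BirchSwinnertonDyer.Theorems.ErratumRoadFiveRamFreeIrrKToIrrQ
import Literature.NumberTheory.EllipticCurves.CMTorsionIrreducibleOrdinaryProofs
import Literature.NumberTheory.Automorphic.QuadraticCharacterTwist
import HarnessLib

/-!
# `Surj W p` ⟹ `ρ̄_{g_m}|_{G_K}` irreducible for every Hida member `g_m` and every quadratic `K` — hypothesis (i) of the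
# erratum's Thm. 2.3 (F4♯‡) and the `irr_K` conjunct of F3♯‡, DERIVED on the surjective locus (helper,
# `--supports stmt-BirchSwinnertonDyer-23253`)

Cell `bsd-stepL`, seat `bsd-stepL-imc-p1` (prover g27, 2026-08-28). Theorems only (no definition, no named fact, no
`sorry`, no instance, no notation). Part 3 (assembly) of the bridge; parts 1, 2a, 2b:
`ErratumRoadFiveTransvectionIrreducibility.lean`, `ErratumRoadFiveTorsionReductionAlgebra.lean`,
`ErratumRoadFiveResidualRepOfMemberTorsion.lean`.

* §1 `exists_transvections_of_surj` — if `ρ̄_{E,p} : Γ_ℚ → Aut(E[p])` is onto, there are `P₁ ≠ 0`, `P₂ ∈ E[p]` and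
  `σ₁, σ₂ ∈ Γ_ℚ` acting as the elementary transvections of the frame (`σ₁ P₁ = P₁`, `σ₁ P₂ = P₁ + P₂`, `σ₂ P₁ = P₁ + P₂`,
  `σ₂ P₂ = P₂`); `isUnit_of_ne_zero_residue` — `𝒪_m/ϖ` is a field (every non-zero class is a unit).
* `isSimpleOrder_subrepresentation_of_transvections_hom` — part 1's criterion in additive-hom form (the transvection
  identities stated inside `E` and pushed through `Θ : E →+ k²`; generic, so that no `k²`-arithmetic is done at `𝒪_m/ϖ`).
* §2 **`isSimpleOrder_subrepresentation_residualRep_comp_of_sq_mem`** — for a Hida member `D` at level `m ≥ 1` of a curve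
  with `Surj W p`, `p` odd, and any `φ : H → Γ_ℚ` whose image contains all squares: `ρ̄_{g_m} ∘ φ` is irreducible.
  Proof: `σᵢ²` acts on `E[p]` by `P₂ ↦ P₂ + 2P₁` resp. `P₁ ↦ P₁ + 2P₂`; transport through the injective equivariant
  `Θ : E[p] → (𝒪_m/ϖ)²` (part 2b) and apply the transvection criterion (part 1) with `c = 2 ∈ (𝒪_m/ϖ)ˣ`.
* §3 **`isSimpleOrder_subrepresentation_residualRep_comp_of_surj`** — the case `φ = res_K : Γ_K → Γ_ℚ`, `[K:ℚ] = 2`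
  (squares lie in the index-two subgroup `Γ_K`): EXACTLY the binder
  `IsSimpleOrder (Subrepresentation ((residualRep D.Δ).comp (absGaloisRestrict ℚ K)))` of F4♯‡
  (`Castella2018.erratumThm23_charIdeal_sigma_le_of_isTorsion_selfDual_irrK_OPEN`, hypothesis (i) «`ρ̄_g|_{G_K}` irreducible»)
  and the `irr_K` conjunct proposed for F3♯‡ (`RAMFREE-REKEY-PROPOSAL.md` §5) — so on the `Surj` locus that conjunct is a
  THEOREM over F3♯†'s member data, not a new cited claim; **`isResiduallyIrreducible_of_surj`** — the case `φ = id`: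
  F3♯†'s own conjunct `SkinnerUrban2014.IsResiduallyIrreducible D.Δ` is likewise redundant given `Surj W p`.

HONEST FRAMING: Galois-module algebra (Serre: a subgroup of `GL₂(𝔽_p)` containing both elementary transvections acts
irreducibly, also after any extension of scalars); nothing about `L`-functions; no item closes; BSD is proved for no pair;
closes: none (T7).

## References
* [Serre1972] §2.4–§2.6 (subgroups of `GL₂(𝔽_p)` generated by transvections).
* [Castella2018Erratum] Thm. 2.3 (i) (p. 3), footnote 1 (p. 4: «`ρ̄_{g_m} ≃ E[p]` … irreducible»).
* [SkinnerUrban2014] §3.3.4 (p. 29), (irred).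
-/

noncomputable section

set_option autoImplicit false
-- D-0017: single-problem summit, the namespace repeats the problem name by design.
set_option linter.dupNamespace false

namespace Summit.BirchSwinnertonDyer.BirchSwinnertonDyer.Theorems.SurjIrrK

open Literature.NumberTheory.GaloisRepresentations Literature.NumberTheory.EllipticCurves
  Literature.NumberTheory.EllipticCurves.GreenbergSelmer Literature.NumberTheory.EllipticCurves.ModularForms
  Field Summit.BirchSwinnertonDyer.BirchSwinnertonDyer.Theorems.ErratumThm23TwoVariable

/-! ## §1 Transvections in the image of a surjective `ρ̄_{E,p}`; the residue field `𝒪/ϖ` -/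

section Frame

variable (W : WeierstrassCurve ℚ) [W.IsElliptic] (p : ℕ) [Fact p.Prime]

/-- **A surjective `ρ̄_{E,p}` realises the two elementary transvections of a frame of `E[p] ≅ 𝔽_p²`**: there are
`P₁ ≠ 0`, `P₂` in `E[p]` and `σ₁, σ₂ ∈ Γ_ℚ` with `σ₁ P₁ = P₁`, `σ₁ P₂ = P₁ + P₂`, `σ₂ P₁ = P₁ + P₂`, `σ₂ P₂ = P₂`.
[cite: Serre1972, §2.4 (transvections in `GL₂(𝔽_p)`)] -/
theorem exists_transvections_of_surj (hsurj : W.HasSurjectiveModNGaloisRep p) :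
    ∃ P₁ P₂ : W.geomTorsion p, P₁ ≠ 0 ∧ ∃ σ₁ σ₂ : absoluteGaloisGroup ℚ,
      σ₁ • P₁ = P₁ ∧ σ₁ • P₂ = P₁ + P₂ ∧ σ₂ • P₁ = P₁ + P₂ ∧ σ₂ • P₂ = P₂ := by
  classical
  letI : Module (ZMod p) (W.geomTorsion p) := AddSubgroup.torsionBy.zmodModule
  have hp : p.Prime := Fact.out
  haveI : Finite (W.geomTorsion p) := Nat.finite_of_card_ne_zero
    (by rw [W.natCard_geomTorsion_natCast hp.ne_zero]; exact pow_ne_zero 2 hp.ne_zero)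
  haveI : Module.Finite (ZMod p) (W.geomTorsion p) := Module.Finite.of_finite
  let b := Module.finBasisOfFinrankEq (ZMod p) (W.geomTorsion p) (W.finrank_zmod_geomTorsion_eq_two p)
  -- the two transvections as additive automorphisms
  have key : ∀ v w : Fin 2 → W.geomTorsion p, (∀ i, b.constr ℕ v (w i) = b i) → (∀ i, b.constr ℕ w (v i) = b i) →
      ∃ σ : absoluteGaloisGroup ℚ, ∀ i, σ • b i = v i := by
    intro v w hvw hwv
    have h1 : (b.constr ℕ v).comp (b.constr ℕ w) = LinearMap.id :=
      b.ext fun i ↦ by rw [LinearMap.comp_apply, Module.Basis.constr_basis, hvw, LinearMap.id_apply]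
    have h2 : (b.constr ℕ w).comp (b.constr ℕ v) = LinearMap.id :=
      b.ext fun i ↦ by rw [LinearMap.comp_apply, Module.Basis.constr_basis, hwv, LinearMap.id_apply]
    let T : W.geomTorsion p ≃ₗ[ZMod p] W.geomTorsion p := LinearEquiv.ofLinear _ _ h1 h2
    obtain ⟨σ, hσ⟩ := hsurj (Multiplicative.ofAdd T.toAddEquiv)
    refine ⟨σ, fun i ↦ ?_⟩
    rw [← WeierstrassCurve.galoisRepTorsion_apply, hσ, toAdd_ofAdd]
    change T (b i) = v i
    exact b.constr_basis ℕ v i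
  obtain ⟨σ₁, hσ₁⟩ := key ![b 0, b 0 + b 1] ![b 0, b 1 - b 0]
    (fun i ↦ by fin_cases i <;> simp [map_sub])
    (fun i ↦ by fin_cases i <;> simp [map_add])
  obtain ⟨σ₂, hσ₂⟩ := key ![b 0 + b 1, b 1] ![b 0 - b 1, b 1]
    (fun i ↦ by fin_cases i <;> simp [map_sub])
    (fun i ↦ by fin_cases i <;> simp [map_add])
  refine ⟨b 0, b 1, b.ne_zero 0, σ₁, σ₂, ?_, ?_, ?_, ?_⟩
  · simpa using hσ₁ 0
  · simpa using hσ₁ 1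
  · simpa using hσ₂ 0
  · simpa using hσ₂ 1

end Frame

section Residue

variable {M : ℕ} {k : ℤ} {g : CuspForm (CongruenceSubgroup.Gamma0 M) k} {p : ℕ} [Fact p.Prime]
  {ι : coeffField g →+* PadicAlgCl p} (Δ : OrdinaryNewformDatum g p ι)

/-- **`𝒪/ϖ` is a field** for the datum's uniformiser: an element of `𝒪` outside `(ϖ)` has norm `1`, hence is a unit, so
every non-zero residue class is a unit. [cite: EmertonPollackWeston2006, §3.1 (p. 17, "uniformizer `π` of `𝒪`", `k = 𝒪/π`)] -/
theorem isUnit_of_ne_zero_residue (x : padicCoeffIntegers ι ⧸ Ideal.span {Δ.ϖ}) (hx : x ≠ 0) : IsUnit x := by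
  obtain ⟨a, rfl⟩ := Ideal.Quotient.mk_surjective x
  have hnot : ¬ Δ.ϖ ∣ a := fun h ↦ hx (Ideal.Quotient.eq_zero_iff_mem.2 (Ideal.mem_span_singleton.2 h))
  have hnorm : ‖padicCoeffIntegers.toPadicAlgCl ι a‖ = 1 :=
    le_antisymm (norm_toPadicAlgCl_le_one ι a) (not_lt.1 fun h ↦ hnot (Δ.dvd_of_norm_lt_one a h))
  have ha0 : (a : padicCoeffField ι) ≠ 0 := fun h ↦ by
    rw [padicCoeffIntegers.toPadicAlgCl_apply, h] at hnorm
    simp at hnorm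
  have hinv : (a : padicCoeffField ι)⁻¹ ∈ padicCoeffIntegers ι := by
    rw [mem_padicCoeffIntegers_iff]
    have e : (((a : padicCoeffField ι)⁻¹ : padicCoeffField ι) : PadicAlgCl p) = ((a : padicCoeffField ι) : PadicAlgCl p)⁻¹ :=
      map_inv₀ (algebraMap (padicCoeffField ι) (PadicAlgCl p)) _
    rw [e, norm_inv, ← padicCoeffIntegers.toPadicAlgCl_apply, hnorm, inv_one]
  have hunit : IsUnit a :=
    ⟨⟨a, ⟨(a : padicCoeffField ι)⁻¹, hinv⟩, Subtype.ext (mul_inv_cancel₀ ha0), Subtype.ext (inv_mul_cancel₀ ha0)⟩, rfl⟩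
  exact hunit.map (Ideal.Quotient.mk (Ideal.span {Δ.ϖ}))

end Residue

section Generic

/-- **Transvection criterion, additive-hom form.** As `isSimpleOrder_subrepresentation_of_transvections` (part 1), but with
the two vectors given as images `Θ P₁`, `Θ P₂` under an injective additive `Θ : E → k²` and the transvection identities
stated inside `E` (`π g₁ (Θ P₂) = Θ (P₂ + n • P₁)`, …) with `n ∈ ℕ` a unit in `k` — the shape delivered by an equivariant
`E[p] ↪ ρ̄` (so that all `k²`-arithmetic happens here, generically). [cite: Serre1972, §2.4–§2.6] -/
theorem isSimpleOrder_subrepresentation_of_transvections_hom {k : Type*} [CommRing k] [Nontrivial k]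
    (hk : ∀ x : k, x ≠ 0 → IsUnit x) {G E : Type*} [Monoid G] [AddCommGroup E]
    (π : Representation k G (Fin 2 → k)) (Θ : E →+ (Fin 2 → k)) (hΘ : Function.Injective Θ)
    (g₁ g₂ : G) (n : ℕ) (hn : IsUnit ((n : ℕ) : k)) {P₁ P₂ : E} (hP₁ : P₁ ≠ 0)
    (h₁₁ : π g₁ (Θ P₁) = Θ P₁) (h₁₂ : π g₁ (Θ P₂) = Θ (P₂ + n • P₁))
    (h₂₁ : π g₂ (Θ P₁) = Θ (P₁ + n • P₂)) (h₂₂ : π g₂ (Θ P₂) = Θ P₂) :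
    IsSimpleOrder (Subrepresentation π) := by
  have hv₁ : Θ P₁ ≠ 0 := fun h ↦ hP₁ (hΘ (h.trans (map_zero Θ).symm))
  refine isSimpleOrder_subrepresentation_of_transvections hk π g₁ g₂ hn hv₁ (v₂ := Θ P₂) h₁₁ ?_ ?_ h₂₂
  · rw [h₁₂, map_add, map_nsmul, Nat.cast_smul_eq_nsmul]
  · rw [h₂₁, map_add, map_nsmul, Nat.cast_smul_eq_nsmul]

end Generic

/-! ## §2 Irreducibility of `ρ̄_{g_m} ∘ φ` when the image of `φ` contains all squares -/

section Main

variable {W : WeierstrassCurve ℚ} [W.IsElliptic] [W.IsGloballyMinimal] {p : ℕ} [Fact p.Prime] {m : ℕ}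

/-- **The transvection data of a member** (`p ∥ N`, `Surj W p`, `m ≥ 1`): an injective additive `Θ : E[p] → (𝒪_m/ϖ)²`
intertwining the Galois actions (part 2b), a point `P₁ ≠ 0` and a second point `P₂` of `E[p]`, and `σ₁, σ₂ ∈ Γ_ℚ` whose
SQUARES act by `P₁ ↦ P₁`, `P₂ ↦ P₂ + 2P₁` resp. `P₁ ↦ P₁ + 2P₂`, `P₂ ↦ P₂` (squares of the elementary transvections of §1).
[cite: Castella2018Erratum, footnote 1 (p. 4: «`ρ̄_{g_m} ≃ E[p]`»)] [cite: Serre1972, §2.4] -/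
theorem exists_transvection_data [NeZero (W.conductorNorm ℤ / p)]
    (hsurj : W.HasSurjectiveModNGaloisRep p) (D : Skinner2016.HidaCongruentMember W p m) (hm : 1 ≤ m) :
    ∃ (Θ : W.geomTorsion p →+ (Fin 2 → padicCoeffIntegers D.ι ⧸ Ideal.span {D.Δ.ϖ})) (P₁ P₂ : W.geomTorsion p)
      (σ₁ σ₂ : absoluteGaloisGroup ℚ),
      Function.Injective Θ ∧
      (∀ (σ : absoluteGaloisGroup ℚ) (P : W.geomTorsion p), Θ (σ • P) = SkinnerUrban2014.residualRep D.Δ σ (Θ P)) ∧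
      P₁ ≠ 0 ∧ (σ₁ * σ₁) • P₁ = P₁ ∧ (σ₁ * σ₁) • P₂ = P₂ + 2 • P₁ ∧
      (σ₂ * σ₂) • P₁ = P₁ + 2 • P₂ ∧ (σ₂ * σ₂) • P₂ = P₂ := by
  -- (`Exists.elim` rather than `obtain`: `rcases` on these existentials is pathologically slow)
  refine (exists_transvections_of_surj W p hsurj).elim fun P₁ hE ↦ hE.elim fun P₂ hE ↦ ?_
  have hP₁ : P₁ ≠ 0 := hE.1
  refine hE.2.elim fun σ₁ hE ↦ hE.elim fun σ₂ hE ↦ ?_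
  have h11 : σ₁ • P₁ = P₁ := hE.1
  have h12 : σ₁ • P₂ = P₁ + P₂ := hE.2.1
  have h21 : σ₂ • P₁ = P₁ + P₂ := hE.2.2.1
  have h22 : σ₂ • P₂ = P₂ := hE.2.2.2
  refine (exists_geomTorsion_residual_hom D hm).elim fun Θ hΘ2 ↦ ?_
  refine ⟨Θ, P₁, P₂, σ₁, σ₂, hΘ2.1, hΘ2.2, hP₁, ?_, ?_, ?_, ?_⟩
  · rw [mul_smul, h11, h11]
  · rw [mul_smul, h12, smul_add, h11, h12, two_nsmul]; abel
  · rw [mul_smul, h21, smul_add, h21, h22, two_nsmul]; abel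
  · rw [mul_smul, h22, h22]

set_option maxHeartbeats 800000 in
-- Two of the four transvection identities are handed over across an instance-path seam (`E[p]` as `AddSubgroup.add` vs the
-- generic `AddCommGroup` projections of the criterion); reconciling them is allocation-heavy (≈ 0.6 M heartbeats, < 10 s).
/-- **`Surj W p` ⟹ `ρ̄_{g_m} ∘ φ` irreducible whenever `φ(H) ⊇ {σ² : σ ∈ Γ_ℚ}`** (`p` odd, `D` a Hida member at level
`m ≥ 1`): the squares `σᵢ²` of the Galois elements realising the elementary transvections of `E[p]` lie in `φ(H)` and act by
`P₂ ↦ P₂ + 2P₁`, `P₁ ↦ P₁ + 2P₂`; through the injective equivariant `Θ : E[p] → (𝒪_m/ϖ)²` they act the same way on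
`Θ(P₁) ≠ 0`, `Θ(P₂)`, and `2 ∈ (𝒪_m/ϖ)ˣ`, so the transvection criterion applies.
[cite: Castella2018Erratum, footnote 1 (p. 4: «`ρ̄_{g_m} ≃ E[p]`»)] [cite: Serre1972, §2.4–§2.6] -/
theorem isSimpleOrder_subrepresentation_residualRep_comp_of_sq_mem [NeZero (W.conductorNorm ℤ / p)]
    (hp : p ≠ 2) (hsurj : W.HasSurjectiveModNGaloisRep p) (D : Skinner2016.HidaCongruentMember W p m) (hm : 1 ≤ m)
    {H : Type*} [Group H] (φ : H →* absoluteGaloisGroup ℚ) (hφ : ∀ σ : absoluteGaloisGroup ℚ, σ * σ ∈ φ.range) :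
    IsSimpleOrder (Subrepresentation ((SkinnerUrban2014.residualRep D.Δ).comp φ)) := by
  haveI := IrrK.nontrivial_residue D.Δ
  refine (exists_transvection_data hsurj D hm).elim fun Θ hE ↦ hE.elim fun P₁ hE ↦ hE.elim fun P₂ hE ↦
    hE.elim fun σ₁ hE ↦ hE.elim fun σ₂ hE ↦ ?_
  have hΘ : Function.Injective Θ := hE.1
  have hΘσ : ∀ (σ : absoluteGaloisGroup ℚ) (P : W.geomTorsion p),
      Θ (σ • P) = SkinnerUrban2014.residualRep D.Δ σ (Θ P) := hE.2.1
  have hP₁ : P₁ ≠ 0 := hE.2.2.1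
  refine (hφ σ₁).elim fun τ₁ hτ₁ ↦ (hφ σ₂).elim fun τ₂ hτ₂ ↦ ?_
  have h2 : IsUnit (((2 : ℕ) : ℕ) : padicCoeffIntegers D.ι ⧸ Ideal.span {D.Δ.ϖ}) := by
    rw [Nat.cast_ofNat]; exact IrrK.isUnit_two_residue D.Δ hp
  refine isSimpleOrder_subrepresentation_of_transvections_hom (isUnit_of_ne_zero_residue D.Δ)
    ((SkinnerUrban2014.residualRep D.Δ).comp φ) Θ hΘ τ₁ τ₂ 2 h2 hP₁ (P₂ := P₂) ?_ ?_ ?_ ?_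
  · show SkinnerUrban2014.residualRep D.Δ (φ τ₁) (Θ P₁) = _
    rw [hτ₁, ← hΘσ, hE.2.2.2.1]
  · show SkinnerUrban2014.residualRep D.Δ (φ τ₁) (Θ P₂) = _
    rw [hτ₁, ← hΘσ, hE.2.2.2.2.1]
  · show SkinnerUrban2014.residualRep D.Δ (φ τ₂) (Θ P₁) = _
    rw [hτ₂, ← hΘσ, hE.2.2.2.2.2.1]
  · show SkinnerUrban2014.residualRep D.Δ (φ τ₂) (Θ P₂) = _
    rw [hτ₂, ← hΘσ, hE.2.2.2.2.2.2]

/-! ## §3 The two instances: `φ = res_K` for a quadratic field `K` (F4♯‡ (i) / F3♯‡ `irr_K`), and `φ = id` ((irred)) -/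

/-- **`Surj W p` ⟹ hypothesis (i) of the erratum's Thm. 2.3 for every Hida member**: for `p` odd, `E/ℚ` with
`ρ̄_{E,p}` surjective (`Surj W p`), a Hida member `D` of `f_E` at level `m ≥ 1` and a quadratic number field `K`, the
residual representation `ρ̄_{g_m}` restricted along `res_K : Γ_K → Γ_ℚ` is irreducible —
`IsSimpleOrder (Subrepresentation ((residualRep D.Δ).comp (absGaloisRestrict ℚ K)))`, VERBATIM the binder (i) of F4♯‡
(`Castella2018.erratumThm23_charIdeal_sigma_le_of_isTorsion_selfDual_irrK_OPEN`) and the `irr_K` conjunct of F3♯‡. Squares of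
`Γ_ℚ` lie in the index-two subgroup `res_K(Γ_K)`. [cite: Castella2018Erratum, Thm. 2.3 (i) (p. 3) and footnote 1 (p. 4)] -/
theorem isSimpleOrder_subrepresentation_residualRep_comp_of_surj [NeZero (W.conductorNorm ℤ / p)]
    (hp : p ≠ 2) (hsurj : W.HasSurjectiveModNGaloisRep p) (D : Skinner2016.HidaCongruentMember W p m) (hm : 1 ≤ m)
    (K : Type) [Field K] [NumberField K] (hK : Module.finrank ℚ K = 2) :
    IsSimpleOrder (Subrepresentation ((SkinnerUrban2014.residualRep D.Δ).comp
      (absGaloisRestrict ℚ K : absoluteGaloisGroup K →* absoluteGaloisGroup ℚ))) := by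
  have hidx := (Literature.NumberTheory.Automorphic.isOpen_range_absGaloisRestrict_and_index_eq_two ℚ K hK).2
  exact isSimpleOrder_subrepresentation_residualRep_comp_of_sq_mem hp hsurj D hm
    (absGaloisRestrict ℚ K : absoluteGaloisGroup K →* absoluteGaloisGroup ℚ)
    fun σ ↦ Subgroup.mul_self_mem_of_index_two hidx σ

/-- **`Surj W p` ⟹ (irred) for every Hida member**: under the same hypotheses (no field `K`), `ρ̄_{g_m}` itself is
irreducible — `SkinnerUrban2014.IsResiduallyIrreducible D.Δ`, the conjunct «`ρ̄_{g_m} ≃ E[p]` is irreducible» of F3♯†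
(`Castella2018.erratum_exists_frames_members_sigma_congruence_nonsplit_wt`), which is therefore redundant on the `Surj` locus.
[cite: Castella2018Erratum, footnote 1 (p. 4)] [cite: SkinnerUrban2014, §3.3.4 (p. 29), (irred)] -/
theorem isResiduallyIrreducible_of_surj [NeZero (W.conductorNorm ℤ / p)]
    (hp : p ≠ 2) (hsurj : W.HasSurjectiveModNGaloisRep p) (D : Skinner2016.HidaCongruentMember W p m) (hm : 1 ≤ m) :
    SkinnerUrban2014.IsResiduallyIrreducible D.Δ :=
  RamFree.isSimpleOrder_subrepresentation_of_comp _ (MonoidHom.id (absoluteGaloisGroup ℚ))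
    (isSimpleOrder_subrepresentation_residualRep_comp_of_sq_mem hp hsurj D hm (MonoidHom.id _)
      fun σ ↦ ⟨σ * σ, rfl⟩)

end Main

end Summit.BirchSwinnertonDyer.BirchSwinnertonDyer.Theorems.SurjIrrK

end
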